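import Summits.AtomisticToContinuum.Crystallization.Theorems.ExcessDecayLiouvilleHcpLiouvilleOfInputs

/-!
# `ExcessDecayLiouville.HcpLiouville` (stmt-AtomisticToContinuum-9332): the ANCHORED / MIS-ANCHORED split

Route `ExcessDecayLiouville` (sub-problem `Crystallization`), crux `HcpLiouville` (rank 3): every separated
Lennard-Jones equilibrium `X ⊂ ℝ³` globally two-way `1/40`-matched with an admissible hcp-like affine two-lattice
datum `(t, A)` is an admissible affine two-lattice (conditionally on the harmonic-stability inequality, inline).

Crux-strategist decomposition (planner, 2026-08-17).  The matching DATUM `(t, A)` of the crux need not itself be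
an equilibrium: `Inner t A` allows its inner displacement to sit `1/40` off the geometric hcp shift, and the
relaxed (force-free) inner shift of the cell `A` sits up to `0.022` off geometric at the pure-shear corners of
`Adm` (kit j014378), so the homogeneous equilibrium two-lattice nearest to `X` ("the anchor") may be `≈ 0.047`
away from the datum in the sublattice-relative sense, and the inter-sublattice bond strains of `X` seen from the
anchor reach `≈ 0.1`.  Every energy-method line for the crux (the dead `two-level-caccioppoli` level 2, the live
blow-down of line `Sketch` v4, `flat-at-infinity-blowdown`, `cell-determinant-convexification`) consumes ONE
inhomogeneous coercivity certificate along the ray anchor → `X`, and the certifiable radius of the known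
correlation-aware architecture (null-Lagrangian-corrected CELLS of the hcp contact complex, kit j011259) is
vertex radius `≈ 1/40` (alive `+0.07…+0.21`), thin at `0.035`, dead at `1/20`.  The split below separates
exactly these regimes:

* anchored Liouville (`h₁`, route item `AnchoredLiouville`) — the crux for data that ARE equilibrium two-lattices (`Equil (Sites t A)` added):
  anchor = datum, ray radius `1/40`, inter-sublattice strain `≤ 1/20`; the blow-down analysis applies with
  anchor shift `τ = 0` and the coercivity input is certifiable cellwise at vertex radius `1/40`.
* equilibrium anchoring (`h₂`, route item `EquilibriumAnchoring`) — the mis-anchored regime in REDUCTION form: every `X` satisfying the typed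
  hypotheses is globally two-way `1/40`-matched with SOME admissible hcp-like datum that is an equilibrium
  two-lattice.  (Sharp in sup-norm, hence Liouville-strength whenever the datum is not already relaxed; it is
  where a counterexample to the crux would live: an equilibrium riding at inner mis-shift `0.03–0.05`, e.g. a
  long-wave modulated two-lattice near the certified long-wave tangent instability of mis-shifted homogeneous
  states, kit j017763.)

`hcpLiouville_of_subs : (anchored Liouville) → (equilibrium anchoring) → HcpLiouville` is the glue (pure logic),
with both hypotheses in mirror-predicate form (`Adm₀/Inner₀/Sites₀/Near₀/Sep₀/Equil₀`); the route items
`AnchoredLiouville` / `EquilibriumAnchoring` are their verbatim `let`-telescope forms (definitionally equal, as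
`BlowdownLine.hcpLiouville_iff : HcpLiouville ↔ … := Iff.rfl` is for the parent).  Everything is `[folklore]` bookkeeping;
nothing here closes an item.
-/

noncomputable section

namespace Summit.AtomisticToContinuum.Crystallization.Theorems.ExcessDecayLiouville

open scoped BigOperators Topology Classical InnerProductSpace
open Literature.MathematicalPhysics.StatisticalMechanics
open Summit.AtomisticToContinuum.Crystallization.Theses.ExcessDecayLiouville
open Summit.AtomisticToContinuum.Crystallization.Theorems.PhononStabilityNegative

/-- **Anchored Liouville ⇒ (Equilibrium anchoring ⇒ the crux)** — the glue of the crux-strategist split of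
`HcpLiouville` into the route items `AnchoredLiouville` (hypothesis `h₁`, here in mirror-predicate form: the crux
restricted to matching data whose site set is itself in force balance, `Equil₀ (Sites₀ t A)`) and
`EquilibriumAnchoring` (hypothesis `h₂`: under the crux's hypotheses `X` is globally two-way `1/40`-matched with an
admissible hcp-like datum whose site set is in force balance).  Pure logic: re-anchor the datum with `h₂`, conclude
with `h₁`.  The route items are the verbatim `let`-telescope forms of `h₁`/`h₂` (definitionally equal). [folklore] -/
theorem hcpLiouville_of_subs :
    (PhononStability → ∀ δ : ℝ, 0 < δ → ∀ X : Set (EuclideanSpace ℝ (Fin 3)), Sep₀ X δ → Equil₀ X → ∀ (t : Fin 2 → (EuclideanSpace ℝ (Fin 3))) (A : (EuclideanSpace ℝ (Fin 3)) →L[ℝ] (EuclideanSpace ℝ (Fin 3))), Adm₀ A → Inner₀ t A → Equil₀ (Sites₀ t A) → (∀ (c : (EuclideanSpace ℝ (Fin 3))) (r : ℝ), Near₀ X c r t A (1 / 40)) → ∃ (t' : Fin 2 → (EuclideanSpace ℝ (Fin 3))) (A' : (EuclideanSpace ℝ (Fin 3)) →L[ℝ] (EuclideanSpace ℝ (Fin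 3))), Adm₀ A' ∧ X = Sites₀ t' A') → (PhononStability → ∀ δ : ℝ, 0 < δ → ∀ X : Set (EuclideanSpace ℝ (Fin 3)), Sep₀ X δ → Equil₀ X → ∀ (t : Fin 2 → (EuclideanSpace ℝ (Fin 3))) (A : (EuclideanSpace ℝ (Fin 3)) →L[ℝ] (EuclideanSpace ℝ (Fin 3))), Adm₀ A → Inner₀ t A → (∀ (c : (EuclideanSpace ℝ (Fin 3))) (r : ℝ), Near₀ X c r t A (1 / 40)) → ∃ (t'' : Fin 2 → (EuclideanSpace ℝ (Fin 3))) (A'' : (EuclideanSpace ℝ (Fin 3)) →L[ℝ] (EuclideanSpace ℝ (Fin 3))), Adm₀ A'' ∧ Inner₀ t'' A'' ∧ Equil₀ (Sites₀ t'' A'') ∧ ∀ (c : (EuclideanSpace ℝ (Fin 3))) (r : ℝ), Near₀ X c r t'' A'' (1 / 40)) → HcpLiouville := by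
  intro h₁ h₂
  rw [BlowdownLine.hcpLiouville_iff]
  intro hPS δ hδ X hSep hEq t A hA hI hN
  obtain ⟨t'', A'', hA'', hI'', hE'', hN''⟩ := h₂ hPS δ hδ X hSep hEq t A hA hI hN
  exact h₁ hPS δ hδ X hSep hEq t'' A'' hA'' hI'' hE'' hN''

end Summit.AtomisticToContinuum.Crystallization.Theorems.ExcessDecayLiouville

end

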